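import Literature.Barriers.SmoothPoincare4.StableInvariantsBlind
import Literature.Barriers.SmoothPoincare4.HCobordismInvariantsBlindProofs
import HarnessLib

/-!
# Barrier (SmoothPoincare4) `StableBarrierFour`: calibration — the barrier IS "every homotopy 4-sphere is chain-stably standard"

Sibling file of `StableInvariantsBlind.lean` and `StableInvariantsBlindProofs.lean` (barrier
catalogue `Literature/Barriers/SmoothPoincare4/`, D-0021; fact seat
`provefact-Literature.Barriers.SmoothPoincare4.Stab…`, triage `SIZE: XL`). The barrier
`Literature.Barriers.SmoothPoincare4.StableBarrierFour` says: every invariant of connected closed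
smooth 4-manifolds which is constant on `S² × S²`-stable diffeomorphism classes
(`Literature.Barriers.SmoothPoincare4.IsStableInvariant`; printed members: semisimple oriented
4-dimensional TFTs, Reutter 2023 Thm. 1, Reutter–Schommer-Pries 2022 Thm. A) takes on every
homotopy 4-sphere `Σ` its value on `S⁴`. It is proved in the tree relative to named facts (Wall
1964 Thm. 3 with `Θ₄ = 0`; or Kirby 1989 Thm. X.3 = Wall's (4.1); `StableInvariantsBlindProofs.lean`).
This file records, sorry-free and without touching the barrier or the technique class, WHAT an
unconditional proof must contain — in the manner of §3 of `HCobordismInvariantsBlindProofs.lean`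
(calibration of the sibling barrier `HCobordismInvariantBarrierFour` against `Θ₄ = 0`), whose
bundling `Literature.Barriers.SmoothPoincare4.ChartedFour` of 4-dimensional charted spaces in
`Type` is reused:

1. **The technique class has a universal member.** With the generating relation
   `ChartedFour.HasCommonStabilization X Y` — "`X`, `Y` are connected closed smooth 4-manifolds and
   some closed smooth `P` is a `k`-fold stabilisation (`Literature.Topology.FourManifolds.IsStabilization k`,
   the tree's relational `· # k(S² × S²)`, Wall 1964 §1) of both" — a function `I` is in the class
   iff it is constant on related pairs (`isStableInvariant_iff`), iff it factors through the class
   map `ChartedFour.stableClass : ChartedFour → Quot HasCommonStabilization`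
   (`isStableInvariant_iff_exists_comp_stableClass`); the class map itself is a stable invariant
   valued in `Type 1` (`isStableInvariant_stableClass`).
2. **Calibration** (`stableBarrierFour_iff_eqvGen`): `StableBarrierFour.{u}`, at ANY value universe
   `u`, holds iff every homotopy 4-sphere is related to `S⁴` by the equivalence relation generated
   by `HasCommonStabilization`. So the value universe is immaterial (`stableBarrierFour_univ_iff`),
   and nothing weaker than "every homotopy 4-sphere is `S² × S²`-stably diffeomorphic to `S⁴`
   through a chain of common stabilisations" can discharge the barrier: an unconditional proof
   must produce, for every `Σ`, actual closed smooth 4-manifolds and stabilisations chaining `Σ`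
   to `S⁴`. Every route in the tree gives a ONE-step chain — a single common stabilisation of `Σ`
   and `S⁴` (`ChartedFour.hasCommonStabilization_sphere_of_exists_isStabilization`,
   `eqvGen_hasCommonStabilization_of_wall_thetaFour`): Wall's Thm. 3 with `Θ₄ = 0`
   (`Literature.Topology.FourManifolds.exists_isStabilization_sphere_of_homotopySphere_four`), or
   Kirby's Thm. X.3 (`StableInvariantsBlindProofs.lean`, Appendix 3).
3. **Not attempted**: collapsing a chain to a single common stabilisation (transitivity of
   "stably diffeomorphic" in the relational form) needs the well-definedness of `M # (S² × S²)` up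
   to diffeomorphism for connected `M` (Kosinski 1993, Ch. VI Thm. (1.1), by the Disc Theorem; in
   the tree only as the named fact `nonempty_diffeomorph_of_isConnectedSum_sphereTwoProd` for
   manifolds WITH boundary, `ExoticContractibleKangProofs.lean`) together with the existence of
   connected sums (`ConnectedSumExistence.lean`); the calibration does not need it, and Reutter's
   Thm. 1 is in any case printed for the one-step relation with the same `n` on both sides
   (footnote to Thm. 1), of which the chain relation is the equivalence closure.

Nothing is defined beyond the two side-condition bundles `ChartedFour.IsClosedSmooth`,
`ChartedFour.IsClosedConnected`, the generating relation and its quotient map (auxiliary to the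
calibration, like `ChartedFour.IsClosedSC` / `IsHCobordantSC` / `hCobordismClass` next door); no
named fact is introduced or discharged.

## References

* C. T. C. Wall, *On simply-connected 4-manifolds*, J. London Math. Soc. 39 (1964) 141–149, §1,
  Thm. 3 and (4.1) (p. 147). [WallJLMS1964]
* D. Reutter, *Semisimple 4-dimensional topological field theories cannot detect exotic smooth
  structure*, J. Topol. 16 (2023), §1.1 Thm. 1 (with its footnote) and Cor. 2. [Reutter2023SemisimpleTFT]
* D. Reutter, C. Schommer-Pries, *Semisimple field theories detect stable diffeomorphism*,
  arXiv:2206.10031, Thm. A and Thm. 1.1. [ReutterSchommerPries2022]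
* M. Kervaire, J. Milnor, *Groups of homotopy spheres I*, Ann. of Math. 77 (1963), table p. 504
  (`Θ₄ = 0`). [KervaireMilnorAnnals1963]
* A. Kosinski, *Differential Manifolds* (1993), Ch. VI §1 Thm. (1.1). [Kosinski1993]
-/

noncomputable section

open scoped Manifold ContDiff

namespace Literature.Barriers.SmoothPoincare4

universe u v

open Literature.Topology.FourManifolds

/-! ### 1. Side conditions and the generating relation, bundled -/

namespace ChartedFour

/-- `X` is a **closed smooth 4-manifold**: Hausdorff, second countable, `C^∞` on `ℝ⁴`, compact —
the side conditions `IsStableInvariant` puts on the common stabilisation `P`.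
[cite: WallJLMS1964, §1] -/
structure IsClosedSmooth (X : ChartedFour) : Prop where
  /-- `X` is Hausdorff. -/
  [t2Space : T2Space X.carrier]
  /-- `X` is second countable. -/
  [secondCountableTopology : SecondCountableTopology X.carrier]
  /-- `X` is a `C^∞` manifold modelled on `ℝ⁴`. -/
  [isManifold : IsManifold (𝓡 4) ∞ X.carrier]
  /-- `X` is compact. -/
  [compactSpace : CompactSpace X.carrier]

/-- `X` is a **connected closed smooth 4-manifold**: the side conditions `IsStableInvariant` puts
on the two manifolds it compares (Reutter's Thm. 1 is printed for "connected compact oriented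
4-bordisms"). [cite: Reutter2023SemisimpleTFT, §1.1 Thm. 1] -/
structure IsClosedConnected (X : ChartedFour) : Prop where
  /-- `X` is Hausdorff. -/
  [t2Space : T2Space X.carrier]
  /-- `X` is second countable. -/
  [secondCountableTopology : SecondCountableTopology X.carrier]
  /-- `X` is a `C^∞` manifold modelled on `ℝ⁴`. -/
  [isManifold : IsManifold (𝓡 4) ∞ X.carrier]
  /-- `X` is compact. -/
  [compactSpace : CompactSpace X.carrier]
  /-- `X` is connected. -/
  [connectedSpace : ConnectedSpace X.carrier]

/-- A connected closed smooth 4-manifold is a closed smooth 4-manifold. [folklore] -/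
theorem IsClosedConnected.isClosedSmooth {X : ChartedFour} (h : X.IsClosedConnected) :
    X.IsClosedSmooth := by
  obtain ⟨⟩ := h
  exact ⟨⟩

/-- A simply connected closed smooth 4-manifold (`ChartedFour.IsClosedSC`, the side condition of
the sibling class `IsHCobordismInvariant`) is a connected closed smooth 4-manifold (simply
connected ⇒ path connected ⇒ connected, Mathlib instances). [folklore] -/
theorem IsClosedSC.isClosedConnected {X : ChartedFour} (h : X.IsClosedSC) : X.IsClosedConnected := by
  obtain ⟨⟩ := h
  exact ⟨⟩

/-- `S⁴` is a connected closed smooth 4-manifold (`π₁(S⁴) = 1`, Hatcher Prop. 1.14, tree theorem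
`simplyConnectedSpace_sphere_four_holds`, through `ChartedFour.isClosedSC_sphere`).
[cite: HatcherAT2002, Prop. 1.14] -/
theorem isClosedConnected_sphere : sphere.IsClosedConnected :=
  isClosedSC_sphere.isClosedConnected

/-- The carrier of a homotopy 4-sphere is a connected closed smooth 4-manifold (through
`ChartedFour.isClosedSC_homotopySphere`: simple connectivity transported along `Σ ≃ₕ S⁴`).
[cite: KervaireMilnorAnnals1963, §1] [cite: HatcherAT2002, Prop. 1.14] -/
theorem isClosedConnected_homotopySphere (S : HomotopySphere 4) :
    (⟨S.carrier⟩ : ChartedFour).IsClosedConnected :=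
  (isClosedSC_homotopySphere S).isClosedConnected

/-- **The generating relation of the technique class `IsStableInvariant`**: `X` and `Y` are
connected closed smooth 4-manifolds and some closed smooth `P` is a `k`-fold stabilisation of both
(`IsStabilization k X P ∧ IsStabilization k Y P`, the tree's relational form of
`X # k(S² × S²) ≅ P ≅ Y # k(S² × S²)`, Wall 1964 §1 — the SAME `k` on both sides, as in the
footnote to Reutter's Thm. 1). Its equivalence closure `Relation.EqvGen HasCommonStabilization` is
the relation "not separated by any stable invariant" (`stableBarrierFour_iff_eqvGen`).
[cite: WallJLMS1964, §1] [cite: Reutter2023SemisimpleTFT, §1.1 Thm. 1 with footnote] -/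
def HasCommonStabilization (X Y : ChartedFour) : Prop :=
  X.IsClosedConnected ∧ Y.IsClosedConnected ∧
    ∃ (k : ℕ) (P : ChartedFour), P.IsClosedSmooth ∧
      IsStabilization k X.carrier P.carrier ∧ IsStabilization k Y.carrier P.carrier

/-- The generating relation is symmetric (swap the two stabilisations). [folklore] -/
theorem HasCommonStabilization.symm {X Y : ChartedFour} (h : X.HasCommonStabilization Y) :
    Y.HasCommonStabilization X := by
  obtain ⟨hX, hY, k, P, hP, hXP, hYP⟩ := h
  exact ⟨hY, hX, k, P, hP, hYP, hXP⟩

/-- The generating relation is reflexive on connected closed smooth 4-manifolds: `X` itself is a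
`0`-fold stabilisation of `X` (`isStabilization_zero_self`, the identity diffeomorphism).
[cite: WallJLMS1964, §1] -/
theorem HasCommonStabilization.refl_of_isClosedConnected {X : ChartedFour}
    (hX : X.IsClosedConnected) : X.HasCommonStabilization X := by
  obtain ⟨⟩ := hX
  exact ⟨⟨⟩, ⟨⟩, 0, X, ⟨⟩, isStabilization_zero_self X.carrier, isStabilization_zero_self X.carrier⟩

/-- **The universal stable invariant**: the class of `X` in the quotient of `ChartedFour` by (the
equivalence relation generated by) `HasCommonStabilization` — the `S² × S²`-stable diffeomorphism
class in the tree's relational vocabulary. It belongs to the technique class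
(`isStableInvariant_stableClass`), and `I` is in the technique class iff it is of the form
`f ∘ stableClass` (`isStableInvariant_iff_exists_comp_stableClass`).
[cite: WallJLMS1964, §1] [cite: ReutterSchommerPries2022, Thm. 1.1 (stable diffeomorphism classes)] -/
def stableClass (X : ChartedFour) : Quot HasCommonStabilization :=
  Quot.mk _ X

/-- A common stabilisation of a homotopy 4-sphere `Σ` and `S⁴` — the conclusion of
`exists_isStabilization_sphere_of_homotopySphere_four` (Wall's Thm. 3 with `Θ₄ = 0`) and of
Kirby's Thm. X.3 applied to `Σ`, `S⁴` — is ONE step of the generating relation.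
[cite: WallJLMS1964, Thm. 3 and (4.1)] -/
theorem hasCommonStabilization_sphere_of_exists_isStabilization (S : HomotopySphere 4)
    (h : ∃ (k : ℕ) (P : Type) (_ : TopologicalSpace P) (_ : T2Space P)
      (_ : SecondCountableTopology P) (_ : ChartedSpace (EuclideanSpace ℝ (Fin 4)) P)
      (_ : CompactSpace P) (_ : IsManifold (𝓡 4) ∞ P),
      IsStabilization k S.carrier P ∧
        IsStabilization k (Metric.sphere (0 : EuclideanSpace ℝ (Fin 5)) 1) P) :
    HasCommonStabilization ⟨S.carrier⟩ sphere := by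
  obtain ⟨k, P, _, _, _, _, _, _, hSP, h4P⟩ := h
  exact ⟨isClosedConnected_homotopySphere S, isClosedConnected_sphere, k, ⟨P⟩, ⟨⟩, hSP, h4P⟩

end ChartedFour

/-! ### 2. The technique class through the bundled relation; its universal member -/

/-- **The technique class, bundled form**: `I` is a stable invariant iff it takes equal values on
`HasCommonStabilization`-related bundled charted spaces (instances in, instances out).
[cite: Reutter2023SemisimpleTFT, §1.1 Thm. 1] [cite: WallJLMS1964, §1] -/
theorem isStableInvariant_iff {α : Type*}
    {I : ∀ (M : Type) [TopologicalSpace M] [ChartedSpace (EuclideanSpace ℝ (Fin 4)) M], α} :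
    IsStableInvariant I ↔
      ∀ X Y : ChartedFour, X.HasCommonStabilization Y → I X.carrier = I Y.carrier := by
  constructor
  · rintro h ⟨M, tM, cM⟩ ⟨N, tN, cN⟩ ⟨⟨⟩, ⟨⟩, k, ⟨P, tP, cP⟩, ⟨⟩, hMP, hNP⟩
    exact h k M N P hMP hNP
  · intro h k M N P _ _ _ _ _ _ _ _ _ _ _ _ _ _ _ _ _ _ _ _ hMP hNP
    exact h ⟨M⟩ ⟨N⟩ ⟨⟨⟩, ⟨⟩, k, ⟨P⟩, ⟨⟩, hMP, hNP⟩

/-- **The stable class is a stable invariant** (valued in `Type 1`): the technique class has a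
universal member. [cite: WallJLMS1964, §1] [cite: ReutterSchommerPries2022, Thm. 1.1] -/
theorem isStableInvariant_stableClass :
    IsStableInvariant
      (fun (M : Type) [TopologicalSpace M] [ChartedSpace (EuclideanSpace ℝ (Fin 4)) M] =>
        ChartedFour.stableClass ⟨M⟩) :=
  isStableInvariant_iff.mpr fun _ _ hXY => Quot.sound hXY

/-- **Every stable invariant factors through the stable class, and conversely**: `I` is in the
technique class iff `I M = f [M]` for some function `f` on `Quot ChartedFour.HasCommonStabilization`
(`⇒`: `f = Quot.lift I`, well defined precisely because `I` is invariant; `⇐`: related manifolds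
have equal classes, `Quot.sound`). [cite: WallJLMS1964, §1] [cite: ReutterSchommerPries2022, Thm. 1.1] -/
theorem isStableInvariant_iff_exists_comp_stableClass {α : Type*}
    {I : ∀ (M : Type) [TopologicalSpace M] [ChartedSpace (EuclideanSpace ℝ (Fin 4)) M], α} :
    IsStableInvariant I ↔
      ∃ f : Quot ChartedFour.HasCommonStabilization → α,
        ∀ (M : Type) [TopologicalSpace M] [ChartedSpace (EuclideanSpace ℝ (Fin 4)) M],
          I M = f (ChartedFour.stableClass ⟨M⟩) := by
  constructor
  · intro hI
    exact ⟨Quot.lift (fun X => I X.carrier) fun X Y h => isStableInvariant_iff.mp hI X Y h,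
      fun M _ _ => rfl⟩
  · rintro ⟨f, hf⟩
    exact isStableInvariant_iff.mpr fun X Y hXY =>
      (hf X.carrier).trans ((congrArg f (Quot.sound hXY)).trans (hf Y.carrier).symm)

/-- **A stable invariant is constant on the equivalence closure of the generating relation**
(equality in `α` being an equivalence relation). [folklore] -/
theorem IsStableInvariant.apply_eq_of_eqvGen {α : Type*}
    {I : ∀ (M : Type) [TopologicalSpace M] [ChartedSpace (EuclideanSpace ℝ (Fin 4)) M], α}
    (hI : IsStableInvariant I) {X Y : ChartedFour}
    (h : Relation.EqvGen ChartedFour.HasCommonStabilization X Y) : I X.carrier = I Y.carrier := by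
  induction h with
  | rel X Y hXY => exact isStableInvariant_iff.mp hI X Y hXY
  | refl _ => rfl
  | symm _ _ _ ih => exact ih.symm
  | trans _ _ _ _ _ ih₁ ih₂ => exact ih₁.trans ih₂

/-! ### 3. Calibration -/

/-- **Calibration of the barrier.** `StableBarrierFour` (at any value universe `u`) holds iff every
homotopy 4-sphere is related to `S⁴` by the equivalence relation generated by "connected closed
smooth, with a common `k`-fold stabilisation" (`ChartedFour.HasCommonStabilization`). (`⇐`: a
stable invariant is constant along such chains. `⇒`: apply the barrier to the `Prop`-valued stable
invariant `M ↦ EqvGen HasCommonStabilization ⟨M⟩ S⁴`, lifted to `Type u`.) Hence an unconditional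
proof of the barrier must produce, for every homotopy 4-sphere `Σ`, actual closed smooth
4-manifolds and `S² × S²`-stabilisations chaining `Σ` to `S⁴`: the content of Wall's Thm. 3 with
`Θ₄ = 0`, or of Kirby's Thm. X.3 for the pair `(Σ, S⁴)`, up to chaining.
[cite: WallJLMS1964, Thm. 3 and (4.1)] [cite: Reutter2023SemisimpleTFT, §1.1 Thm. 1 and Cor. 2] [cite: ReutterSchommerPries2022, Thm. 1.1] -/
theorem stableBarrierFour_iff_eqvGen :
    StableBarrierFour.{u} ↔
      ∀ S : HomotopySphere 4,
        Relation.EqvGen ChartedFour.HasCommonStabilization ⟨S.carrier⟩ ChartedFour.sphere := by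
  constructor
  · intro h S
    have hI : IsStableInvariant
        (fun (M : Type) [TopologicalSpace M] [ChartedSpace (EuclideanSpace ℝ (Fin 4)) M] =>
          ULift.up.{u}
            (Relation.EqvGen ChartedFour.HasCommonStabilization ⟨M⟩ ChartedFour.sphere)) := by
      refine isStableInvariant_iff.mpr fun X Y hXY =>
        ULift.ext _ _ (propext ⟨fun hX => ?_, fun hY => ?_⟩)
      · exact Relation.EqvGen.trans _ _ _ (Relation.EqvGen.rel _ _ hXY.symm) hX
      · exact Relation.EqvGen.trans _ _ _ (Relation.EqvGen.rel _ _ hXY) hY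
    exact (congrArg ULift.down (h _ _ hI S)).mpr (Relation.EqvGen.refl _)
  · intro h α I hI S
    exact hI.apply_eq_of_eqvGen (h S)

/-- **The value universe is immaterial**: the barrier for invariants valued in `Type u` is
equivalent to the barrier for invariants valued in `Type v` (both are the universe-free chain
condition of `stableBarrierFour_iff_eqvGen`). [folklore] -/
theorem stableBarrierFour_univ_iff : StableBarrierFour.{u} ↔ StableBarrierFour.{v} :=
  stableBarrierFour_iff_eqvGen.trans stableBarrierFour_iff_eqvGen.symm

/-- **What the barrier yields back**: GIVEN `StableBarrierFour` (at some universe), every homotopy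
4-sphere is chained to `S⁴` by common stabilisations among connected closed smooth 4-manifolds.
[cite: WallJLMS1964, Thm. 3 and (4.1)] -/
theorem StableBarrierFour.eqvGen_hasCommonStabilization (h : StableBarrierFour.{u})
    (S : HomotopySphere 4) :
    Relation.EqvGen ChartedFour.HasCommonStabilization ⟨S.carrier⟩ ChartedFour.sphere :=
  stableBarrierFour_iff_eqvGen.mp h S

/-- **One-step chains suffice, and are what the tree's routes give**: if every homotopy 4-sphere has
a common `k`-fold stabilisation with `S⁴` by a closed smooth `P`, the chain condition holds with
chains of length one (so `StableBarrierFour` follows, `stableBarrierFour_iff_eqvGen`; cf.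
`stableBarrierFour_of_forall_exists_isStabilization` in `StableInvariantsBlindProofs.lean`).
[cite: WallJLMS1964, Thm. 3 and (4.1)] -/
theorem eqvGen_hasCommonStabilization_of_forall_exists_isStabilization
    (h : ∀ S : HomotopySphere 4, ∃ (k : ℕ) (P : Type) (_ : TopologicalSpace P) (_ : T2Space P)
      (_ : SecondCountableTopology P) (_ : ChartedSpace (EuclideanSpace ℝ (Fin 4)) P)
      (_ : CompactSpace P) (_ : IsManifold (𝓡 4) ∞ P),
      IsStabilization k S.carrier P ∧
        IsStabilization k (Metric.sphere (0 : EuclideanSpace ℝ (Fin 5)) 1) P)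
    (S : HomotopySphere 4) :
    Relation.EqvGen ChartedFour.HasCommonStabilization ⟨S.carrier⟩ ChartedFour.sphere :=
  Relation.EqvGen.rel _ _ (ChartedFour.hasCommonStabilization_sphere_of_exists_isStabilization S (h S))

/-- **The one-step chain from Wall's Thm. 3 and `Θ₄ = 0`** (tree facts
`exists_isStabilization_of_isHCobordant`, `isHCobordant_sphere_of_homotopySphere_four`; `π₁(S⁴) = 1`
is the tree theorem `simplyConnectedSpace_sphere_four_holds`), through
`exists_isStabilization_sphere_of_homotopySphere_four` (`WallStabilisation.lean`).
[cite: WallJLMS1964, Thm. 3] [cite: KervaireMilnorAnnals1963, table p. 504 (Θ₄ = 0)] -/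
theorem eqvGen_hasCommonStabilization_of_wall_thetaFour
    (hW : exists_isStabilization_of_isHCobordant)
    (hΘ : isHCobordant_sphere_of_homotopySphere_four) (S : HomotopySphere 4) :
    Relation.EqvGen ChartedFour.HasCommonStabilization ⟨S.carrier⟩ ChartedFour.sphere :=
  eqvGen_hasCommonStabilization_of_forall_exists_isStabilization
    (exists_isStabilization_sphere_of_homotopySphere_four hW hΘ simplyConnectedSpace_sphere_four_holds) S

/-! ### 4. Comparison with the sibling barrier: GIVEN Wall's Thm. 3, stable invariants are h-cobordism invariants -/

/-- **GIVEN Wall's Thm. 3, every stable invariant is an h-cobordism invariant.** If h-cobordant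
simply connected closed smooth 4-manifolds are `S² × S²`-stably diffeomorphic (Wall 1964, Thm. 3;
tree fact `exists_isStabilization_of_isHCobordant`, hypothesis `hW`), then a function constant on
common stabilisations of connected closed smooth 4-manifolds (`IsStableInvariant`) is constant on
smooth h-cobordism classes of simply connected closed smooth 4-manifolds (`IsHCobordismInvariant`,
the technique class of `HCobordismInvariantsBlind.lean`; simply connected ⇒ connected). This is the
inclusion of technique classes behind "semisimple TFTs are h-cobordism invariants in dimension 4"
as used for unitary theories by FKNSWW 2005, Thm. 4.1, there obtained directly.
[cite: WallJLMS1964, Thm. 3] [cite: Reutter2023SemisimpleTFT, §1.1 Thm. 1 and Cor. 2] -/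
theorem IsStableInvariant.isHCobordismInvariant {α : Type*}
    {I : ∀ (M : Type) [TopologicalSpace M] [ChartedSpace (EuclideanSpace ℝ (Fin 4)) M], α}
    (hI : IsStableInvariant I) (hW : exists_isStabilization_of_isHCobordant) :
    IsHCobordismInvariant I := by
  intro M N _ _ _ _ _ _ _ _ _ _ _ _ _ _ hMN
  obtain ⟨k, P, _, _, _, _, _, _, hMP, hNP⟩ := hW M N hMN
  exact hI k M N P hMP hNP

/-- **GIVEN Wall's Thm. 3, the h-cobordism barrier implies the stable barrier** (at the same value
universe): apply `HCobordismInvariantBarrierFour` to a stable invariant, which is an h-cobordism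
invariant by `IsStableInvariant.isHCobordismInvariant`. (With
`hCobordismInvariantBarrierFour_of_theta_four` this is `stableBarrierFour_of_wall_thetaFour` of
`StableInvariantsBlindProofs.lean` factored through the sibling barrier.)
[cite: WallJLMS1964, Thm. 3] [cite: FKNSWW2005, Thm. 4.1] -/
theorem stableBarrierFour_of_hCobordismInvariantBarrierFour
    (hW : exists_isStabilization_of_isHCobordant) (h : HCobordismInvariantBarrierFour.{u}) :
    StableBarrierFour.{u} :=
  fun α I hI S => h α I (hI.isHCobordismInvariant hW) S

end Literature.Barriers.SmoothPoincare4

end
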